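import Summits.QuantumFields.QCD.Theses.QuarksAsStableAction

/-!
# `QuarksAsStableAction.StableActionBridgeOfSplit` (support item stmt-QuantumFields-17395) — the glue of the
# bridge's two-regime decomposition, and the placement of the crux `StableActionBridge` (stmt-QuantumFields-9737)
# after route-repair 0d71b161 (2026-08-16T23:21Z, route rev 8)

Line `Sketch` of crux `StableActionBridge`, continuation lead c7, cycle 8.

The planner promoted the two held stubs of the lead skeleton `Cruxes/StableActionBridge/Lines/Sketch.lean` to items:
`ThresholdQCD` (shared crux stmt-QuantumFields-8794, the pre-re-type threshold content, rendered in BOTH route files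
`QuarksAsStableAction` and `HeavyThresholdYMBridge` with the same text) and `ChiralCompletion` (crux stmt-QuantumFields-17394,
the delta of the statement re-type p117723: pinned `m_crit`, light quarks, `IsChiralAtZero`), glued by the support
`StableActionBridgeOfSplit := ThresholdQCD → ChiralCompletion → StableActionBridge`.

This file proves the glue BY NAME (`stableActionBridgeOfSplit_proof`, pure logic, the hypotheses A and S of the bridge
unused) and records the dockings the re-cut skeleton relies on:

* (docking of the shared item 8794: the rendering of `ThresholdQCD` in this route file and the original one in
  `HeavyThresholdYMBridge` have the same text and are definitionally equal — recorded as `Iff.rfl` in the skeleton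
  `Lines/Sketch.lean`, not here, to keep this file's import cone to the one route file;)
* `chiralCompletion_of_qcd`, `thresholdQCD_of_qcd'` — both split items are implied by the conjunct `QCD` itself, hence
* `qcd_iff_thresholdQCD_and_chiralCompletion : QCD ↔ (ThresholdQCD ∧ ChiralCompletion)` — the split is LOSSLESS;
* `stableActionBridge_of_thresholdQCD_of_chiralCompletion` — the skeleton's composition in item vocabulary.

Pure theorem file over the route decls; no definitions, no analysis.
-/

namespace Summit.QuantumFields.QCD.Theorems

open Summit.QuantumFields.QCD.Theses.QuarksAsStableAction (UnquenchedChessboardBound WilsonQuarkStability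
  StableActionBridge StableActionBridgeOfSplit ChiralCompletion ThresholdQCD)

/-- **Glue of the split (item stmt-QuantumFields-17395, BY NAME).**  From the threshold form (`ThresholdQCD`, item 8794)
and the chiral completion (`ChiralCompletion`, item 17394) the bridge `StableActionBridge := A → S → QCD` follows by
instantiating both at `N_f = 2` and `N_f = 3`; the hypotheses A and S are not used. [folklore] -/
theorem stableActionBridgeOfSplit_proof : StableActionBridgeOfSplit :=
  fun hT hC _ _ => ⟨hC 2 (Or.inl rfl) (hT 2 (Or.inl rfl)), hC 3 (Or.inr rfl) (hT 3 (Or.inr rfl))⟩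

/-- The skeleton's composition in item vocabulary: `ThresholdQCD → ChiralCompletion → StableActionBridge`
(the same term, stated with the arrows unfolded for use by `Lines/Sketch.lean`). [folklore] -/
theorem stableActionBridge_of_thresholdQCD_of_chiralCompletion (hT : ThresholdQCD) (hC : ChiralCompletion) :
    StableActionBridge :=
  stableActionBridgeOfSplit_proof hT hC

/-- `QCD → ThresholdQCD` (route-QuarksAsStableAction rendering): drop `IsChiralAtZero` and take the offset `M₀ = 0`.
[folklore] -/
theorem thresholdQCD_of_qcd' (h : _root_.QCD) : ThresholdQCD := by
  intro Nf hNf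
  rcases hNf with rfl | rfl
  · obtain ⟨reg, hMS, -, hall⟩ := h.1
    exact ⟨0, le_rfl, reg, hMS, hall⟩
  · obtain ⟨reg, hMS, -, hall⟩ := h.2
    exact ⟨0, le_rfl, reg, hMS, hall⟩

/-- `QCD → ChiralCompletion`: the completion's conclusion `QCDOf N_f` (`N_f = 2, 3`) is a conjunct of `QCD`, whatever
the threshold hypothesis says. [folklore] -/
theorem chiralCompletion_of_qcd (h : _root_.QCD) : ChiralCompletion := by
  intro Nf hNf _
  rcases hNf with rfl | rfl
  · exact h.1
  · exact h.2

/-- **The split is lossless**: `QCD ↔ (ThresholdQCD ∧ ChiralCompletion)` — the conjunct `QCD := QCDOf 2 ∧ QCDOf 3`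
is equivalent to the conjunction of the two items the bridge was split into. [folklore] -/
theorem qcd_iff_thresholdQCD_and_chiralCompletion : _root_.QCD ↔ (ThresholdQCD ∧ ChiralCompletion) :=
  ⟨fun h => ⟨thresholdQCD_of_qcd' h, chiralCompletion_of_qcd h⟩,
    fun h => ⟨h.2 2 (Or.inl rfl) (h.1 2 (Or.inl rfl)), h.2 3 (Or.inr rfl) (h.1 3 (Or.inr rfl))⟩⟩

end Summit.QuantumFields.QCD.Theorems
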